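import Mathlib

/-!
# Stub `helper_compactDomination` of line `Sketch` (skeleton v13) for crux `TameOrBrodyR4` (stmt-SmoothPoincare4-7826, route SullivanDual)

(G5) A compactly supported continuous field `K` of real-linear operators on `ℂ` is dominated by a
continuous field `L` of *injective* real-linear operators: there is `M ≥ 0` with
`‖K η v‖ ≤ M ‖L η v‖` for all `η v`.

How (compactness): on the compact set `closedBall 0 ρ₁` the operator norm `‖K η‖` is bounded by
some `B ≥ 0` (`IsCompact.exists_bound_of_continuousOn`); on the compact set
`closedBall 0 ρ₁ ×ˢ sphere 0 1` the continuous function `(η, u) ↦ ‖L η u‖` is strictly positive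
(injectivity of `L η` and `u ≠ 0` on the unit sphere), hence bounded below by some `m > 0`
(`IsCompact.exists_forall_le'`, which also covers the empty case). Then `M := B / m` works:
outside the ball `K η = 0`; inside, for `v ≠ 0` write `v = ‖v‖ • u` with `u` on the unit sphere
and use real-linearity of `K η`, `L η`.

In the planar reduction of the transversality stub this converts the equation `∂̄G = K η (g η)`,
`G = L η (g η)`, into the pointwise inequality `‖∂̄G‖ ≤ M ‖G‖` used by the similarity principle.

Sources: elementary point-set topology / linear algebra (extreme value theorem); Mathlib only.
-/

open Set Metric

-- the registered namespace `Summit.SmoothPoincare4.SmoothPoincare4.…` repeats a component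
set_option linter.dupNamespace false

noncomputable section

namespace Summit.SmoothPoincare4.SmoothPoincare4.Cruxes.TameOrBrodyR4.Sketch

namespace CompactDomination

/-- A continuous operator field has operator norm bounded by a nonnegative constant on the closed
ball `closedBall 0 ρ₁`. -/
theorem exists_opNorm_bound (K : ℂ → (ℂ →L[ℝ] ℂ)) (ρ₁ : ℝ) (hK : Continuous K) :
    ∃ B : ℝ, 0 ≤ B ∧ ∀ η ∈ closedBall (0 : ℂ) ρ₁, ‖K η‖ ≤ B := by
  obtain ⟨B, hB⟩ :=
    (isCompact_closedBall (0 : ℂ) ρ₁).exists_bound_of_continuousOn hK.norm.continuousOn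
  refine ⟨max B 0, le_max_right _ _, fun η hη => ?_⟩
  have h := hB η hη
  rw [norm_norm] at h
  exact h.trans (le_max_left _ _)

/-- A continuous field of injective operators is uniformly bounded below on unit vectors over the
closed ball `closedBall 0 ρ₁`: there is `m > 0` with `m ≤ ‖L η u‖` for `‖η‖ ≤ ρ₁`, `‖u‖ = 1`. -/
theorem exists_pos_lower_bound (L : ℂ → (ℂ →L[ℝ] ℂ)) (ρ₁ : ℝ) (hL : Continuous L)
    (hLinj : ∀ η v, L η v = 0 → v = 0) :
    ∃ m : ℝ, 0 < m ∧ ∀ η ∈ closedBall (0 : ℂ) ρ₁, ∀ u ∈ sphere (0 : ℂ) 1, m ≤ ‖L η u‖ := by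
  have hT : IsCompact (closedBall (0 : ℂ) ρ₁ ×ˢ sphere (0 : ℂ) 1) :=
    (isCompact_closedBall 0 ρ₁).prod (isCompact_sphere 0 1)
  have hcont : Continuous fun p : ℂ × ℂ => ‖L p.1 p.2‖ :=
    ((hL.comp continuous_fst).clm_apply continuous_snd).norm
  have hpos : ∀ p ∈ closedBall (0 : ℂ) ρ₁ ×ˢ sphere (0 : ℂ) 1, (0 : ℝ) < ‖L p.1 p.2‖ := by
    rintro ⟨η, u⟩ ⟨-, hu⟩
    have hu1 : ‖u‖ = 1 := mem_sphere_zero_iff_norm.mp hu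
    refine norm_pos_iff.mpr fun h => ?_
    have h0 : u = 0 := hLinj η u h
    rw [h0, norm_zero] at hu1
    exact zero_ne_one hu1
  obtain ⟨m, hm, hmle⟩ := hT.exists_forall_le' hcont.continuousOn hpos
  exact ⟨m, hm, fun η hη u hu => hmle (η, u) ⟨hη, hu⟩⟩

/-- Normalisation: a non-zero vector is its norm times a unit vector. -/
theorem exists_unit_smul (v : ℂ) (hv : v ≠ 0) :
    ∃ u ∈ sphere (0 : ℂ) 1, v = (‖v‖ : ℝ) • u := by
  have hvpos : 0 < ‖v‖ := norm_pos_iff.mpr hv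
  refine ⟨(‖v‖⁻¹ : ℝ) • v, ?_, ?_⟩
  · rw [mem_sphere_zero_iff_norm, norm_smul, norm_inv, norm_norm, inv_mul_cancel₀ hvpos.ne']
  · rw [smul_smul, mul_inv_cancel₀ hvpos.ne', one_smul]

end CompactDomination

/-- (G5) **Compact domination.** Let `K L : ℂ → (ℂ →L[ℝ] ℂ)` be continuous operator fields with
`K η = 0` for `ρ₁ ≤ ‖η‖` and every `L η` injective. Then there is `M ≥ 0` with
`‖K η v‖ ≤ M * ‖L η v‖` for all `η v : ℂ`. -/
theorem helper_compactDomination (K L : ℂ → (ℂ →L[ℝ] ℂ)) (ρ₁ : ℝ) (hK : Continuous K)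
    (hL : Continuous L) (hK0 : ∀ η : ℂ, ρ₁ ≤ ‖η‖ → K η = 0)
    (hLinj : ∀ η v, L η v = 0 → v = 0) :
    ∃ M : ℝ, 0 ≤ M ∧ ∀ η v, ‖K η v‖ ≤ M * ‖L η v‖ := by
  obtain ⟨B, hB0, hB⟩ := CompactDomination.exists_opNorm_bound K ρ₁ hK
  obtain ⟨m, hm, hmle⟩ := CompactDomination.exists_pos_lower_bound L ρ₁ hL hLinj
  refine ⟨B / m, div_nonneg hB0 hm.le, fun η v => ?_⟩
  by_cases hη : ρ₁ ≤ ‖η‖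
  · rw [hK0 η hη, zero_apply, norm_zero]
    positivity
  · have hηmem : η ∈ closedBall (0 : ℂ) ρ₁ := by
      rw [mem_closedBall, dist_zero_right]
      exact (not_le.mp hη).le
    by_cases hv : v = 0
    · subst hv
      simp
    · obtain ⟨u, hu, hvu⟩ := CompactDomination.exists_unit_smul v hv
      have hvnn : 0 ≤ ‖v‖ := norm_nonneg v
      have hK1 : ‖K η v‖ = ‖v‖ * ‖K η u‖ := by
        conv_lhs => rw [hvu]
        rw [ContinuousLinearMap.map_smul, norm_smul, Real.norm_of_nonneg hvnn]
      have hL1 : ‖L η v‖ = ‖v‖ * ‖L η u‖ := by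
        conv_lhs => rw [hvu]
        rw [ContinuousLinearMap.map_smul, norm_smul, Real.norm_of_nonneg hvnn]
      have hKu : ‖K η u‖ ≤ B :=
        calc ‖K η u‖ ≤ ‖K η‖ * ‖u‖ := (K η).le_opNorm u
          _ = ‖K η‖ := by rw [mem_sphere_zero_iff_norm.mp hu, mul_one]
          _ ≤ B := hB η hηmem
      have hLu : m ≤ ‖L η u‖ := hmle η hηmem u hu
      rw [hK1, hL1]
      calc ‖v‖ * ‖K η u‖ ≤ ‖v‖ * B := mul_le_mul_of_nonneg_left hKu hvnn
        _ = B / m * (‖v‖ * m) := by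
          field_simp
        _ ≤ B / m * (‖v‖ * ‖L η u‖) :=
          mul_le_mul_of_nonneg_left (mul_le_mul_of_nonneg_left hLu hvnn) (div_nonneg hB0 hm.le)

end Summit.SmoothPoincare4.SmoothPoincare4.Cruxes.TameOrBrodyR4.Sketch
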